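import Mathlib
import Summits.Ventures.HodgeRepro.CMType
import Summits.Ventures.HodgeRepro.HodgeSets
import Summits.Ventures.HodgeRepro.CMRank
import Summits.Ventures.HodgeRepro.MuTable
import Summits.Ventures.HodgeRepro.MuDecide
import Summits.Ventures.HodgeRepro.MuPairs

/-!
# Rank and antipodal pairs (blind cell `pub-hodge-repro`, seat p2)

Group the characters `x_s` into *antipodal classes*: `s ≈ t` iff `w_s = w_t` or `w_s = 1 − w_t`.
Pick one representative `r` per class (`antiReps Φ`).  The weights `w_r` together with the all-ones
vector span the column space of the μ-table, whose dimension is `cmRank Φ`.  Hence if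
`cmRank Φ = #(antipodal classes) + 1`, the family `{1} ∪ {w_r}` is linearly independent, and then the
balance condition `Σ_{s ∈ Δ} w_s = p·1` of a Hodge set forces `|Δ ∩ class(r)| = |Δ ∩ class(1 − r)|`
for every class: every nonempty Hodge set contains an antipodal pair, so every Hodge set is a
disjoint union of antipodal pairs (`MuPairs.lean`).

For a nondegenerate (rank `|Φ| + 1`) primitive type the classes are the pairs `{s, c s}` and this is
White's observation (Gordon §9.3).  For the rank-`4` types of the degree-`6/8/12` census
(`[G : rstab Φ] = 6`, three antipodal classes) the hypothesis `cmRank Φ = 3 + 1` holds as well: all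
their Hodge classes are products of `(1,1)`-classes.
-/

open Finset
open scoped Pointwise

namespace HodgeRepro

variable {G : Type*} [Group G] [DecidableEq G] [Fintype G]

/-- The antipodal equivalence on characters: equal or antipodal weights. -/
def antiSetoid (Φ : Finset G) : Setoid G where
  r s t := weight Φ s = weight Φ t ∨ weight Φ s = 1 - weight Φ t
  iseqv :=
    { refl := fun _ => Or.inl rfl
      symm := by
        rintro s t (h | h)
        · exact Or.inl h.symm
        · right; rw [h]; abel
      trans := by
        rintro s t u (h1 | h1) (h2 | h2)
        · exact Or.inl (h1.trans h2)
        · right; rw [h1, h2]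
        · right; rw [h1, h2]
        · left; rw [h1, h2]; abel }

omit [Fintype G] in
/-- The antipodal setoid unfolds: equal weights, or weights adding up to the all-ones vector. -/
theorem antiSetoid_iff (Φ : Finset G) (s t : G) :
    antiSetoid Φ s t ↔ (weight Φ s = weight Φ t ∨ weight Φ s = 1 - weight Φ t) := Iff.rfl

/-- A representative of the antipodal class of `s`. -/
noncomputable def antiRep (Φ : Finset G) (s : G) : G := (Quotient.mk (antiSetoid Φ) s).out

omit [Fintype G] in
/-- `antiRep Φ s` is in the antipodal class of `s`. -/
theorem antiRep_equiv (Φ : Finset G) (s : G) : antiSetoid Φ (antiRep Φ s) s :=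
  Quotient.mk_out (s := antiSetoid Φ) s

omit [Fintype G] in
/-- Two elements have the same representative exactly when they are antipodally related. -/
theorem antiRep_eq_antiRep_iff (Φ : Finset G) (s t : G) :
    antiRep Φ s = antiRep Φ t ↔ antiSetoid Φ s t := by
  unfold antiRep
  rw [Quotient.out_inj, Quotient.eq]

omit [Fintype G] in
/-- `antiRep` is idempotent. -/
theorem antiRep_antiRep (Φ : Finset G) (s : G) : antiRep Φ (antiRep Φ s) = antiRep Φ s :=
  (antiRep_eq_antiRep_iff Φ _ _).2 (antiRep_equiv Φ s)

/-- One representative per antipodal class. -/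
noncomputable def antiReps (Φ : Finset G) : Finset G := univ.image (antiRep Φ)

/-- Every representative lies in `antiReps Φ`. -/
theorem antiRep_mem_antiReps (Φ : Finset G) (s : G) : antiRep Φ s ∈ antiReps Φ :=
  mem_image.2 ⟨s, mem_univ _, rfl⟩

/-- A member of `antiReps Φ` is its own representative. -/
theorem antiRep_eq_self_of_mem {Φ : Finset G} {r : G} (hr : r ∈ antiReps Φ) : antiRep Φ r = r := by
  obtain ⟨s, _, rfl⟩ := mem_image.1 hr
  exact antiRep_antiRep Φ s

/-- The spanning family: the all-ones vector and one weight per antipodal class. -/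
noncomputable def antiFam (Φ : Finset G) : Option (antiReps Φ) → (G → ℚ) :=
  fun o => o.elim 1 fun r => weight Φ r

/-- The column space of the μ-table. -/
theorem cmRank_eq_finrank_span_weight (Φ : Finset G) :
    cmRank Φ = Module.finrank ℚ (Submodule.span ℚ (Set.range (weight Φ))) := by
  unfold cmRank
  rw [Matrix.rank_eq_finrank_span_cols]
  rfl

/-- The weights of the representatives and `1` span the column space. -/
theorem span_antiFam {c : G} {Φ : Finset G} (hc : IsComplexConj c) (hΦ : IsCMType c Φ) :
    Submodule.span ℚ (Set.range (antiFam Φ)) = Submodule.span ℚ (Set.range (weight Φ)) := by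
  apply le_antisymm
  · rw [Submodule.span_le]
    rintro _ ⟨o, rfl⟩
    rcases o with _ | ⟨r, hr⟩
    · -- `1 = w_1 + w_c`
      have h : (1 : G → ℚ) = weight Φ 1 + weight Φ (c * 1) := by
        rw [weight_conj hc hΦ]; abel
      show (1 : G → ℚ) ∈ Submodule.span ℚ (Set.range (weight Φ))
      rw [h]
      exact Submodule.add_mem _ (Submodule.subset_span ⟨1, rfl⟩) (Submodule.subset_span ⟨c * 1, rfl⟩)
    · exact Submodule.subset_span ⟨r, rfl⟩
  · rw [Submodule.span_le]
    rintro _ ⟨s, rfl⟩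
    have hmem : weight Φ (antiRep Φ s) ∈ Submodule.span ℚ (Set.range (antiFam Φ)) :=
      Submodule.subset_span ⟨some ⟨antiRep Φ s, antiRep_mem_antiReps Φ s⟩, rfl⟩
    have hone : (1 : G → ℚ) ∈ Submodule.span ℚ (Set.range (antiFam Φ)) :=
      Submodule.subset_span ⟨none, rfl⟩
    rcases antiRep_equiv Φ s with h | h
    · show weight Φ s ∈ _
      rw [← h]; exact hmem
    · show weight Φ s ∈ _
      have : weight Φ s = 1 - weight Φ (antiRep Φ s) := by rw [h]; abel
      rw [this]
      exact Submodule.sub_mem _ hone hmem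

/-- The rank is at most the number of antipodal classes plus one (the family `{1} ∪ {w_r}` spans the
column space): the hypothesis of the pairs theorem is "the rank is as large as the weight census allows". -/
theorem cmRank_le_card_antiReps_add_one {c : G} {Φ : Finset G} (hc : IsComplexConj c) (hΦ : IsCMType c Φ) :
    cmRank Φ ≤ (antiReps Φ).card + 1 := by
  rw [cmRank_eq_finrank_span_weight, ← span_antiFam hc hΦ]
  calc Module.finrank ℚ (Submodule.span ℚ (Set.range (antiFam Φ)))
      ≤ Fintype.card (Option (antiReps Φ)) := finrank_range_le_card (antiFam Φ)
    _ = (antiReps Φ).card + 1 := by rw [Fintype.card_option, Fintype.card_coe]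

/-- If the rank equals the number of antipodal classes plus one, the family `{1} ∪ {w_r}` is linearly
independent. -/
theorem linearIndependent_antiFam {c : G} {Φ : Finset G} (hc : IsComplexConj c) (hΦ : IsCMType c Φ)
    (hrank : cmRank Φ = (antiReps Φ).card + 1) : LinearIndependent ℚ (antiFam Φ) := by
  rw [linearIndependent_iff_card_eq_finrank_span]
  show Fintype.card (Option (antiReps Φ)) = Module.finrank ℚ (Submodule.span ℚ (Set.range (antiFam Φ)))
  rw [span_antiFam hc hΦ, ← cmRank_eq_finrank_span_weight, hrank, Fintype.card_option,
    Fintype.card_coe]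

/-- The fibre of the representative map over `r` splits into the characters with weight `w_r` and
those with weight `1 − w_r`. -/
theorem filter_antiRep_eq {Φ : Finset G} (Δ : Finset G) {r : G} (hr : r ∈ antiReps Φ) :
    Δ.filter (fun s => antiRep Φ s = r) =
      Δ.filter (fun s => weight Φ s = weight Φ r) ∪
        Δ.filter (fun s => weight Φ s = 1 - weight Φ r) := by
  ext s
  simp only [mem_filter, mem_union]
  constructor
  · rintro ⟨hs, h⟩
    have := (antiRep_eq_antiRep_iff Φ s r).1 (by rw [h, antiRep_eq_self_of_mem hr])
    rcases this with h' | h'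
    · exact Or.inl ⟨hs, h'⟩
    · exact Or.inr ⟨hs, h'⟩
  · rintro (⟨hs, h⟩ | ⟨hs, h⟩)
    · refine ⟨hs, ?_⟩
      rw [← antiRep_eq_self_of_mem hr, antiRep_eq_antiRep_iff]
      exact Or.inl h
    · refine ⟨hs, ?_⟩
      rw [← antiRep_eq_self_of_mem hr, antiRep_eq_antiRep_iff]
      exact Or.inr h

/-- The two halves of an antipodal class in `Δ` (same weight as `r`, or the complementary weight) are disjoint. -/
theorem disjoint_filter_weight {Φ : Finset G} (Δ : Finset G) (r : G) :
    Disjoint (Δ.filter (fun s => weight Φ s = weight Φ r))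
      (Δ.filter (fun s => weight Φ s = 1 - weight Φ r)) := by
  rw [disjoint_filter]
  intro s _ h1 h2
  rw [h1] at h2
  have := congrFun h2 1
  simp only [Pi.sub_apply, Pi.one_apply, weight_apply] at this
  split_ifs at this <;> norm_num at this

/-- In a Hodge set, each antipodal class is balanced: as many characters of weight `w_r` as of weight
`1 − w_r` (under the rank hypothesis). -/
theorem card_filter_weight_eq_card_filter_antipode {c : G} {Φ : Finset G} (hc : IsComplexConj c)
    (hΦ : IsCMType c Φ) (hrank : cmRank Φ = (antiReps Φ).card + 1) {Δ : Finset G}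
    (hΔ : IsHodgeSet c Φ Δ) {r : G} (hr : r ∈ antiReps Φ) :
    (Δ.filter (fun s => weight Φ s = weight Φ r)).card =
      (Δ.filter (fun s => weight Φ s = 1 - weight Φ r)).card := by
  obtain ⟨p, hp⟩ := hΔ.even_card hc hΦ
  have hcard : Δ.card = 2 * p := by omega
  have hsum := (isHodgeSet_iff_sum_weight hc hΦ Δ p hcard).1 hΔ
  -- the coefficient functions
  set a : G → ℕ := fun r => (Δ.filter (fun s => weight Φ s = weight Φ r)).card with ha
  set b : G → ℕ := fun r => (Δ.filter (fun s => weight Φ s = 1 - weight Φ r)).card with hb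
  -- fibrewise decomposition of the weight sum
  have hfib : ∑ s ∈ Δ, weight Φ s =
      ∑ r ∈ antiReps Φ, ((a r : ℚ) • weight Φ r + (b r : ℚ) • (1 - weight Φ r)) := by
    rw [← sum_fiberwise_of_maps_to (g := antiRep Φ) (t := antiReps Φ)
      (fun s _ => antiRep_mem_antiReps Φ s)]
    refine sum_congr rfl fun r hr => ?_
    rw [filter_antiRep_eq Δ hr, sum_union (disjoint_filter_weight Δ r)]
    congr 1
    · rw [sum_congr rfl (fun s hs => (mem_filter.1 hs).2), sum_const, ← Nat.cast_smul_eq_nsmul ℚ]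
    · rw [sum_congr rfl (fun s hs => (mem_filter.1 hs).2), sum_const, ← Nat.cast_smul_eq_nsmul ℚ]
  -- the linear relation among `1` and the `w_r`
  set g : Option (antiReps Φ) → ℚ := fun o => o.elim ((∑ r ∈ antiReps Φ, (b r : ℚ)) - p)
    (fun r => (a r : ℚ) - b r) with hg
  have hrel : ∑ o, g o • antiFam Φ o = 0 := by
    rw [Fintype.sum_option]
    have h1 : ∑ r : antiReps Φ, g (some r) • antiFam Φ (some r) =
        ∑ r ∈ antiReps Φ, ((a r : ℚ) - b r) • weight Φ r := by
      rw [← sum_coe_sort (antiReps Φ)]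
      rfl
    rw [h1]
    have h2 : ∑ r ∈ antiReps Φ, ((a r : ℚ) - b r) • weight Φ r =
        ∑ r ∈ antiReps Φ, ((a r : ℚ) • weight Φ r + (b r : ℚ) • (1 - weight Φ r)) -
          (∑ r ∈ antiReps Φ, (b r : ℚ)) • (1 : G → ℚ) := by
      rw [sum_smul, ← sum_sub_distrib]
      refine sum_congr rfl fun r _ => ?_
      simp only [sub_smul, smul_sub]
      abel
    rw [h2, ← hfib, hsum]
    show ((∑ r ∈ antiReps Φ, (b r : ℚ)) - p) • (1 : G → ℚ) +
      ((fun _ => (p : ℚ)) - (∑ r ∈ antiReps Φ, (b r : ℚ)) • (1 : G → ℚ)) = 0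
    ext x
    simp only [Pi.add_apply, Pi.sub_apply, Pi.smul_apply, Pi.one_apply, smul_eq_mul, Pi.zero_apply]
    ring
  have hli := Fintype.linearIndependent_iff.1 (linearIndependent_antiFam hc hΦ hrank) g hrel
  have := hli (some ⟨r, hr⟩)
  simp only [hg, Option.elim] at this
  have : (a r : ℚ) = b r := by linarith
  exact_mod_cast this

/-- Under the rank hypothesis every nonempty Hodge set contains an antipodal pair. -/
theorem exists_antipodal_of_isHodgeSet {c : G} {Φ : Finset G} (hc : IsComplexConj c)
    (hΦ : IsCMType c Φ) (hrank : cmRank Φ = (antiReps Φ).card + 1) {Δ : Finset G}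
    (hΔ : IsHodgeSet c Φ Δ) (hne : Δ.Nonempty) : ∃ s ∈ Δ, ∃ t ∈ Δ, IsAntipodal Φ s t := by
  obtain ⟨s, hs⟩ := hne
  set r := antiRep Φ s with hr
  have hrR : r ∈ antiReps Φ := antiRep_mem_antiReps Φ s
  have hbal := card_filter_weight_eq_card_filter_antipode hc hΦ hrank hΔ hrR
  rcases antiRep_equiv Φ s with h | h
  · -- `w_r = w_s`: `s` counts on the `w_r` side, so the antipodal side is nonempty
    have hpos : 0 < (Δ.filter (fun x => weight Φ x = weight Φ r)).card :=
      card_pos.2 ⟨s, mem_filter.2 ⟨hs, h.symm⟩⟩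
    rw [hbal] at hpos
    obtain ⟨t, ht⟩ := card_pos.1 hpos
    rw [mem_filter] at ht
    refine ⟨s, hs, t, ht.1, ?_⟩
    unfold IsAntipodal
    rw [ht.2, ← h]; abel
  · -- `w_r = 1 − w_s`: `s` counts on the antipodal side
    have hpos : 0 < (Δ.filter (fun x => weight Φ x = 1 - weight Φ r)).card :=
      card_pos.2 ⟨s, mem_filter.2 ⟨hs, by rw [h]; abel⟩⟩
    rw [← hbal] at hpos
    obtain ⟨t, ht⟩ := card_pos.1 hpos
    rw [mem_filter] at ht
    refine ⟨s, hs, t, ht.1, ?_⟩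
    unfold IsAntipodal
    rw [ht.2, h]; abel

/-! ### Counting the antipodal classes -/

omit [Fintype G] in
/-- No weight is its own antipode (they differ at `g = 1`). -/
theorem weight_ne_one_sub_weight (Φ : Finset G) (r : G) : weight Φ r ≠ 1 - weight Φ r := by
  intro h
  have := congrFun h 1
  simp only [Pi.sub_apply, Pi.one_apply, weight_apply] at this
  split_ifs at this <;> norm_num at this

/-- The weights are the union of the pairs `{w_r, 1 − w_r}`, `r` a representative. -/
theorem image_weight_eq_biUnion {c : G} {Φ : Finset G} (hc : IsComplexConj c) (hΦ : IsCMType c Φ) :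
    univ.image (weight Φ) = (antiReps Φ).biUnion (fun r => {weight Φ r, 1 - weight Φ r}) := by
  ext w
  simp only [mem_image, mem_univ, true_and, mem_biUnion, mem_insert, mem_singleton]
  constructor
  · rintro ⟨s, rfl⟩
    refine ⟨antiRep Φ s, antiRep_mem_antiReps Φ s, ?_⟩
    rcases antiRep_equiv Φ s with h | h
    · exact Or.inl h.symm
    · right; rw [h]; abel
  · rintro ⟨r, _, (rfl | rfl)⟩
    · exact ⟨r, rfl⟩
    · exact ⟨c * r, weight_conj hc hΦ r⟩

/-- The pairs `{w_r, 1 − w_r}` of distinct representatives are disjoint. -/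
theorem pairwiseDisjoint_antiReps (Φ : Finset G) :
    (antiReps Φ : Set G).PairwiseDisjoint (fun r => ({weight Φ r, 1 - weight Φ r} : Finset (G → ℚ))) := by
  intro r hr r' hr' hne
  rw [Function.onFun, disjoint_iff_ne]
  intro w hw w' hw'
  simp only [mem_insert, mem_singleton] at hw hw'
  intro heq
  apply hne
  rw [← antiRep_eq_self_of_mem hr, ← antiRep_eq_self_of_mem hr', antiRep_eq_antiRep_iff,
    antiSetoid_iff]
  rcases hw with rfl | rfl <;> rcases hw' with rfl | rfl
  · exact Or.inl heq
  · exact Or.inr heq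
  · right; rw [← heq]; abel
  · left
    have : weight Φ r = weight Φ r' := by
      have h := congrArg (fun v => (1 : G → ℚ) - v) heq
      simpa using h
    exact this

/-- Twice the number of antipodal classes is the number of distinct weights. -/
theorem two_mul_card_antiReps {c : G} {Φ : Finset G} (hc : IsComplexConj c) (hΦ : IsCMType c Φ) :
    2 * (antiReps Φ).card = (univ.image (weight Φ)).card := by
  rw [image_weight_eq_biUnion hc hΦ, card_biUnion (pairwiseDisjoint_antiReps Φ)]
  rw [sum_congr rfl (fun r _ => card_pair (weight_ne_one_sub_weight Φ r)), sum_const, smul_eq_mul,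
    mul_comm]

/-- The number of antipodal classes in kernel-computable form: half the number of distinct integer
weights. -/
theorem two_mul_card_antiReps_eq_card_weightsN {c : G} {Φ : Finset G} (hc : IsComplexConj c)
    (hΦ : IsCMType c Φ) : 2 * (antiReps Φ).card = (weightsN Φ).card := by
  rw [two_mul_card_antiReps hc hΦ, card_image_weight]

/-- The rank hypothesis of the pairs theorem, in computable form: `cmRank Φ = #weightsN Φ / 2 + 1`. -/
theorem card_antiReps_add_one_eq {c : G} {Φ : Finset G} (hc : IsComplexConj c) (hΦ : IsCMType c Φ)
    {k : ℕ} (hk : (weightsN Φ).card = 2 * k) : (antiReps Φ).card + 1 = k + 1 := by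
  have := two_mul_card_antiReps_eq_card_weightsN hc hΦ
  omega

/-- **Pairs theorem.**  If `cmRank Φ = #(antipodal classes) + 1`, every Hodge set of `Φ` is a disjoint
union of antipodal pairs; i.e. every Hodge class is a product of `(1,1)`-classes. -/
theorem isPairUnion_of_isHodgeSet {c : G} {Φ : Finset G} (hc : IsComplexConj c) (hΦ : IsCMType c Φ)
    (hrank : cmRank Φ = (antiReps Φ).card + 1) {Δ : Finset G} (hΔ : IsHodgeSet c Φ Δ) :
    IsPairUnion Φ Δ :=
  isPairUnion_of_forall_exists_antipodal hc hΦ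
    (fun _ hΔ' hne => exists_antipodal_of_isHodgeSet hc hΦ hrank hΔ' hne) Δ hΔ

/-- **Pairs theorem, computable form.**  If the μ-table has `2k` distinct columns and `cmRank Φ = k + 1`,
every Hodge set is a disjoint union of antipodal pairs. -/
theorem isPairUnion_of_isHodgeSet' {c : G} {Φ : Finset G} (hc : IsComplexConj c) (hΦ : IsCMType c Φ)
    {k : ℕ} (hk : (weightsN Φ).card = 2 * k) (hrank : cmRank Φ = k + 1) {Δ : Finset G}
    (hΔ : IsHodgeSet c Φ Δ) : IsPairUnion Φ Δ :=
  isPairUnion_of_isHodgeSet hc hΦ (by rw [card_antiReps_add_one_eq hc hΦ hk]; exact hrank) hΔ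

end HodgeRepro
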